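import Summits.Parity.GeneralizedHardyLittlewood.Theorems.BeyondDiagonalBeatsQuarter.OffDiagDualAssembly
import Summits.Parity.GeneralizedHardyLittlewood.Theorems.BeyondDiagonalBeatsQuarter.OffDiagDivisorSwitchSeries
import HarnessLib

/-!
# Route `PrimeLevelFamEdge`, crux K_B (stmt-Parity-20343), line `diagonal_kernel_split` rev 4, plan Ω,
# sub-line Ω-e/f interface (OMEGA-BLUEPRINT L6′) — **the dual series of a box in `(h₁, s)`-form:
# `Σ_{h∈ℤ²} Φ̂(h/C)·N_C(a,b;h) = Σ_{h₁ unit mod C} Σ_{s∈ℤ, h₁∣ab+Cs} Φ̂(h₁/C, s/h₁ + ab/(h₁C))` (coprime stratum)**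

Joins Ω-d5/W-a (`OffDiagDual.dualCount_eq_ite_of_isUnit`: in the coprime stratum `N = 𝟙[h₁ unit ∧ h₁h₂ ≡ ab]`) with the
series divisor switch (`OffDiag.tsum_hyperbola_eq_tsum_switch`): the dual series of one box weight, at Petersson modulus `C`
(`= q(r+1)`), becomes a sum over the dual modulus `h₁` and the switched variable `s`, with the second frequency in the
SHIFTED-LATTICE form `s/h₁ + τ`, `τ = ab/(h₁C)` — exactly the shape consumed by the completion lemmas
(`OffDiagDualCompletion*`, `OffDiagPrincipalBlock`) and, after summing over the levels `q`, by `OffDiagLevelAP` (for fixed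
`(h₁, s)` the levels with `h₁ ∣ ab + q(r+1)s` form an arithmetic progression mod `|h₁|`, `dvd_iff_natCast_level_eq`).

* `intCast_ne_zero_of_isUnit` — a unit class mod `C ≥ 2` is not the class of `0`;
* `switch_frequency_eq` — under `h₁ ∣ ab + Cs`: `((ab+Cs)/h₁ : ℤ)/C = s/h₁ + ab/(h₁·C)` as reals;
* **`tsum_dual_eq_tsum_switch`** — the identity above (summability of the `ℤ²`-family as hypothesis; for the box weights
  it is `OffDiag.summable_dual`).

Bookkeeping over landed theorems; theorems only; standard axioms. Helper toward `stub_offDiagBelowSlack_io`; closes nothing.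
«The programme SEARCHES and TYPES; no claim about Landau–Siegel zeros, Theorems 1–2 of arXiv:2211.02515 or
a repaired Margin232 until a kernel theorem says so.»
-/

noncomputable section

open Finset
open scoped Real FourierTransform

namespace Summit.Parity.GeneralizedHardyLittlewood.Theorems.BeyondDiagonalBeatsQuarter.OffDiag

open Literature.NumberTheory.Sieve.FriedlanderIwaniecPrimes (fourier2)
open OffDiagDual (dualCount_eq_ite_of_isUnit)

variable {C : ℕ} [NeZero C]

omit [NeZero C] in
/-- A unit class modulo `C ≥ 2` is not the class of `0`; so a unit dual modulus is a non-zero integer. [folklore] -/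
theorem intCast_ne_zero_of_isUnit (hC : 2 ≤ C) {h₁ : ℤ} (hu : IsUnit ((h₁ : ℤ) : ZMod C)) : h₁ ≠ 0 := by
  rintro rfl
  rw [Int.cast_zero] at hu
  haveI : Nontrivial (ZMod C) := ZMod.nontrivial_iff.mpr (by omega)
  exact not_isUnit_zero hu

/-- Under the divisibility `h₁ ∣ ab + Cs` (and `h₁, C ≠ 0`) the switched second frequency is a shifted lattice point:
`((ab + Cs)/h₁ : ℤ)/C = s/h₁ + ab/(h₁·C)`. [folklore] -/
theorem switch_frequency_eq {a b h₁ s : ℤ} (hh₁ : h₁ ≠ 0) (hd : h₁ ∣ a * b + (C : ℤ) * s) :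
    (((a * b + (C : ℤ) * s) / h₁ : ℤ) : ℝ) / (C : ℝ) = (s : ℝ) / h₁ + (a * b : ℝ) / ((h₁ : ℝ) * C) := by
  have hC0 : (C : ℝ) ≠ 0 := by exact_mod_cast NeZero.ne C
  have hh0 : (h₁ : ℝ) ≠ 0 := by exact_mod_cast hh₁
  rw [Int.cast_div hd (by exact_mod_cast hh₁)]
  push_cast
  field_simp
  ring

/-- **The dual series of a box in `(h₁, s)`-form (coprime stratum).** For `C ≥ 2`, naturals `a, b` with `a` a unit mod `C`,
and any `Φ : ℝ → ℝ → ℂ` whose dual family `h ↦ Φ̂(h/C)·N_C(a,b;h)` is summable: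
`Σ_{h∈ℤ²} Φ̂(h₁/C,h₂/C)·N_C(a,b;h₁,h₂)
   = Σ_{h₁∈ℤ} 𝟙[h₁ unit mod C]·Σ_{s∈ℤ} 𝟙[h₁ ∣ ab + Cs]·Φ̂(h₁/C, s/h₁ + ab/(h₁C))`.
[cite: KowalskiMichelVanderKam2000, Lemma 3.3 p. 9 — derivation] -/
theorem tsum_dual_eq_tsum_switch (hC : 2 ≤ C) {a : ℕ} (ha : IsUnit ((a : ℕ) : ZMod C)) (b : ℕ) (Φ : ℝ → ℝ → ℂ)
    (hS : Summable fun h : ℤ × ℤ ↦ fourier2 Φ (h.1 / C) (h.2 / C) *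
      (dualCount C (a : ZMod C) (b : ZMod C) (h.1 : ZMod C) (h.2 : ZMod C) : ℂ)) :
    ∑' h : ℤ × ℤ, fourier2 Φ (h.1 / C) (h.2 / C) *
        (dualCount C (a : ZMod C) (b : ZMod C) (h.1 : ZMod C) (h.2 : ZMod C) : ℂ) =
      ∑' h₁ : ℤ, (if IsUnit ((h₁ : ℤ) : ZMod C) then
        ∑' s : ℤ, (if h₁ ∣ (a : ℤ) * b + (C : ℤ) * s then
          fourier2 Φ (h₁ / C) ((s : ℝ) / h₁ + ((a : ℤ) * b : ℝ) / ((h₁ : ℝ) * C)) else 0) else 0) := by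
  classical
  rw [hS.tsum_prod]
  refine tsum_congr fun h₁ ↦ ?_
  -- the coprime-stratum indicator
  have hN : ∀ h₂ : ℤ, (dualCount C (a : ZMod C) (b : ZMod C) (h₁ : ZMod C) (h₂ : ZMod C) : ℂ) =
      if IsUnit ((h₁ : ℤ) : ZMod C) ∧ ((h₁ : ℤ) : ZMod C) * ((h₂ : ℤ) : ZMod C) = (a : ZMod C) * (b : ZMod C)
      then 1 else 0 := by
    intro h₂
    rw [dualCount_eq_ite_of_isUnit ha]
    split_ifs <;> simp
  simp_rw [hN]
  by_cases hu : IsUnit ((h₁ : ℤ) : ZMod C)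
  · rw [if_pos hu]
    have hh₁ : h₁ ≠ 0 := intCast_ne_zero_of_isUnit hC hu
    -- reduce to the congruence indicator and switch
    have hstep : ∀ h₂ : ℤ, fourier2 Φ (h₁ / C) (h₂ / C) *
        (if IsUnit ((h₁ : ℤ) : ZMod C) ∧ ((h₁ : ℤ) : ZMod C) * ((h₂ : ℤ) : ZMod C) = (a : ZMod C) * (b : ZMod C)
          then (1 : ℂ) else 0) =
        (if ((h₁ : ℤ) : ZMod C) * ((h₂ : ℤ) : ZMod C) = ((a : ℤ) : ZMod C) * ((b : ℤ) : ZMod C)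
          then fourier2 Φ (h₁ / C) (((h₂ : ℤ) : ℝ) / C) else 0) := by
      intro h₂
      by_cases hc : ((h₁ : ℤ) : ZMod C) * ((h₂ : ℤ) : ZMod C) = (a : ZMod C) * (b : ZMod C)
      · rw [if_pos ⟨hu, hc⟩, mul_one, if_pos (by push_cast; exact hc)]
      · rw [if_neg (fun h ↦ hc h.2), mul_zero, if_neg (by push_cast; exact hc)]
    simp_rw [hstep]
    rw [tsum_hyperbola_eq_tsum_switch (M := ℂ) (le_trans (by norm_num) hC) hh₁]
    refine tsum_congr fun s ↦ ?_
    by_cases hd : h₁ ∣ (a : ℤ) * b + (C : ℤ) * s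
    · rw [if_pos hd, if_pos hd, switch_frequency_eq hh₁ hd]
      push_cast
      ring_nf
    · rw [if_neg hd, if_neg hd]
  · rw [if_neg hu]
    simp [hu]

end Summit.Parity.GeneralizedHardyLittlewood.Theorems.BeyondDiagonalBeatsQuarter.OffDiag
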